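import Mathlib
import HarnessLib
import Literature.MathematicalPhysics.QuantumLattice.HubbardUVSymbolFrameShift
import Literature.MathematicalPhysics.QuantumLattice.HubbardUVSymbolCTDifferences
import Summits.HubbardSuperconductivity.HubbardSuperconductivity.Theorems.KLProgrammeKLRegimeSplitFrameDist
import Summits.HubbardSuperconductivity.HubbardSuperconductivity.Theorems.KLProgrammeKLRegimeEngineCovarianceResponseAtPoint

/-!
# K3 gen-7-FLOW, S6 door (1) (plan g16 K3-FLOW RULING F, KL STATUS 2026-08-27 l.2548/2588): the scale-`n` FRAME-SHIFT VALUE response of the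
# one-shot covariance `C^K_{>Λ}` and of the two-leg kernel — at EVERY scale, no smallness of the frame against the scale

Cell gate-hubbard-kl, seat p2 g10.  In scheme F the scale-`n` step compares the one-shot actions at the frames `K_n` and `K_{n−1}` (the (α′) cross-frame
clauses of `EngineBoundsAtV17F`, allowance `frameShiftBar`); the covariances are `normalCovariance (uvSymbolCT … K Λ_n)` with symbol
`Ψ_{e_K}(ω_i) = uvSymbolFn (βL²) Λ (e_K(k⃗)) ω_i`, `e_K = ξ − K(p_k⃗)` (`uvSymbolCT_eq_uvSymbolFn`).  The frames are NOT small against `Λ_n` at deep scales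
(`|K_n| ~ |U| ≫ Λ_n`), so the resummed door (p519430/p520898, `|K| ≤ Λ/4`) is the wrong tool here; the un-resummed symbol is GLOBALLY `e`-Lipschitz
(`norm_uvSymbolFn_sub_le`, p524431), which gives, with NO hypothesis on the frames:

* `norm_uvSymbolCT_sub_le_abs` / `norm_uvSymbolCT_sub_le` — per point: `‖Ψ_K − Ψ_{K′}‖(ks) ≤ (2B₁+1)βL²/max(|ω_i|,Λ/2)²·|K(p) − K′(p)| ≤ … · frameDist K K′`,
  and the uniform `norm_uvSymbolCT_sub_le_unif` (`≤ 4(2B₁+1)βL²/Λ²·frameDist K K′`);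
* **`sum_norm_uvSymbolCT_sub_le`** — ℓ¹ over all `ks`: `Σ_{ks} ‖Ψ_K − Ψ_{K′}‖ ≤ 2L²·((2B₁+1)βL²)·(2β/Λ)·frameDist K K′` (Matsubara envelope sum
  `sum_inv_uvEnv_pow_le`, every `M`);
* **`covResp_norm_selfEnergy_frameShift_sub_le`** — composed with the generic door `covResp_norm_selfEnergy_sub_le` (p515302): under its hypotheses along the
  interpolation `C^{K₀}_{>Λ} + t(C^{K₁}_{>Λ} − C^{K₀}_{>Λ})` (`Z_t ≠ 0`, four-leg kernels at the reading point `≤ N`, the two-leg kernel `≤ S`),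
  `‖Σ[𝒢(C^{K₁}_{>Λ},V_U)] − Σ[𝒢(C^{K₀}_{>Λ},V_U)]‖(k,σ) ≤ 2|β|L²·(12·(2L²(2B₁+1)βL²(2β/Λ)·frameDist K₁ K₀)·N + 2·(4(2B₁+1)βL²/Λ²·frameDist K₁ K₀)·S²)` —
  LINEAR in `frameDist K₁ K₀`, valid at every scale `Λ = Λ_n`; with `frameDist K_n K_{n−1} ≤ Gfr₀|U|16^{−(n−1)}` ((I-F jets)) this is the `4^{−n}` decay
  of `frameShiftBar`.

Proofs only; `N`, `S`, `B₁` are hypotheses; nothing about their sizes is asserted.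
-/

noncomputable section

namespace Summit.HubbardSuperconductivity.HubbardSuperconductivity.Theorems.EngineV8

set_option linter.dupNamespace false -- summit = problem name (single-conjunct summit), D-0017

open Literature.MathematicalPhysics.QuantumLattice Literature.Probability.LatticeModels
open Summit.HubbardSuperconductivity.HubbardSuperconductivity.Theorems.KLRegimeSplit

variable {L M : ℕ} [NeZero L]

/-- **Per-point frame-shift response of the UV symbol, in `|K(p) − K′(p)|`**: no hypothesis on the frames. -/
theorem norm_uvSymbolCT_sub_le_abs {B₁ : ℝ} (hB : ∀ y, |deriv salmhoferCutoff y| ≤ B₁) {β : ℝ} (hβ : 0 < β) {Λ : ℝ} (hΛ : 0 < Λ) (μ : ℝ)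
    (K K' : TrigPolyC4v) (i : MatsubaraIdx M) (kv : TorusSite 2 L) (σ : Fin 2) :
    ‖uvSymbolCT L M β μ K Λ ((i, kv), σ) - uvSymbolCT L M β μ K' Λ ((i, kv), σ)‖ ≤
      (2 * B₁ + 1) * (β * (L : ℝ) ^ 2) / max |matsubaraFreq β M i| (Λ / 2) ^ 2 *
        |K.eval (latticeMomentum L kv) - K'.eval (latticeMomentum L kv)| := by
  have hL : (0 : ℝ) < L := by exact_mod_cast NeZero.pos L
  rw [uvSymbolCT_eq_uvSymbolFn hβ, uvSymbolCT_eq_uvSymbolFn hβ]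
  have h := norm_uvSymbolFn_sub_le (c := β * (L : ℝ) ^ 2) hΛ (by positivity) hB (matsubaraFreq β M i) (nambuXiCT L μ K kv)
    (nambuXiCT L μ K' kv)
  have he : |nambuXiCT L μ K kv - nambuXiCT L μ K' kv| = |K.eval (latticeMomentum L kv) - K'.eval (latticeMomentum L kv)| := by
    rw [nambuXiCT, nambuXiCT, abs_sub_comm]; congr 1; ring
  rwa [he] at h

/-- **Per-point frame-shift response in `frameDist`**: `‖Ψ_K − Ψ_{K′}‖(ks) ≤ (2B₁+1)βL²/max(|ω_i|,Λ/2)²·frameDist K K′`. -/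
theorem norm_uvSymbolCT_sub_le {B₁ : ℝ} (hB : ∀ y, |deriv salmhoferCutoff y| ≤ B₁) {β : ℝ} (hβ : 0 < β) {Λ : ℝ} (hΛ : 0 < Λ) (μ : ℝ)
    (K K' : TrigPolyC4v) (i : MatsubaraIdx M) (kv : TorusSite 2 L) (σ : Fin 2) :
    ‖uvSymbolCT L M β μ K Λ ((i, kv), σ) - uvSymbolCT L M β μ K' Λ ((i, kv), σ)‖ ≤
      (2 * B₁ + 1) * (β * (L : ℝ) ^ 2) / max |matsubaraFreq β M i| (Λ / 2) ^ 2 * frameDist K K' := by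
  have hL : (0 : ℝ) < L := by exact_mod_cast NeZero.pos L
  have hB0 : 0 ≤ B₁ := (abs_nonneg _).trans (hB 0)
  have hm : 0 < max |matsubaraFreq β M i| (Λ / 2) := uvEnv_pos hΛ _
  refine (norm_uvSymbolCT_sub_le_abs hB hβ hΛ μ K K' i kv σ).trans ?_
  exact mul_le_mul_of_nonneg_left (abs_eval_sub_le_frameDist K K' _) (by positivity)

/-- **Uniform per-point form**: `‖Ψ_K − Ψ_{K′}‖(ks) ≤ 4(2B₁+1)βL²/Λ²·frameDist K K′`. -/
theorem norm_uvSymbolCT_sub_le_unif {B₁ : ℝ} (hB : ∀ y, |deriv salmhoferCutoff y| ≤ B₁) {β : ℝ} (hβ : 0 < β) {Λ : ℝ} (hΛ : 0 < Λ) (μ : ℝ)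
    (K K' : TrigPolyC4v) (i : MatsubaraIdx M) (kv : TorusSite 2 L) (σ : Fin 2) :
    ‖uvSymbolCT L M β μ K Λ ((i, kv), σ) - uvSymbolCT L M β μ K' Λ ((i, kv), σ)‖ ≤
      4 * ((2 * B₁ + 1) * (β * (L : ℝ) ^ 2)) / Λ ^ 2 * frameDist K K' := by
  have hL : (0 : ℝ) < L := by exact_mod_cast NeZero.pos L
  have hB0 : 0 ≤ B₁ := (abs_nonneg _).trans (hB 0)
  rw [uvSymbolCT_eq_uvSymbolFn hβ, uvSymbolCT_eq_uvSymbolFn hβ]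
  have h := norm_uvSymbolFn_sub_le_unif (c := β * (L : ℝ) ^ 2) hΛ (by positivity) hB (matsubaraFreq β M i) (nambuXiCT L μ K kv)
    (nambuXiCT L μ K' kv)
  have he : |nambuXiCT L μ K kv - nambuXiCT L μ K' kv| = |K.eval (latticeMomentum L kv) - K'.eval (latticeMomentum L kv)| := by
    rw [nambuXiCT, nambuXiCT, abs_sub_comm]; congr 1; ring
  rw [he] at h
  exact h.trans (mul_le_mul_of_nonneg_left (abs_eval_sub_le_frameDist K K' _) (by positivity))

/-- **ℓ¹ frame-shift response of the UV symbol over all momenta/frequencies/spins**: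
`Σ_{ks} ‖Ψ_K − Ψ_{K′}‖ ≤ 2L²·((2B₁+1)βL²)·(2β/Λ)·frameDist K K′` (the Matsubara envelope sum `Σ_i max(|ω_i|,Λ/2)^{−2} ≤ 2β/Λ`, every `M`). -/
theorem sum_norm_uvSymbolCT_sub_le {B₁ : ℝ} (hB : ∀ y, |deriv salmhoferCutoff y| ≤ B₁) {β : ℝ} (hβ : 0 < β) {Λ : ℝ} (hΛ : 0 < Λ) (μ : ℝ)
    (K K' : TrigPolyC4v) :
    ∑ ks : FreqMomentum L M × Fin 2, ‖uvSymbolCT L M β μ K Λ ks - uvSymbolCT L M β μ K' Λ ks‖ ≤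
      2 * (L : ℝ) ^ 2 * ((2 * B₁ + 1) * (β * (L : ℝ) ^ 2)) * (2 * β / Λ) * frameDist K K' := by
  classical
  have hL : (0 : ℝ) < L := by exact_mod_cast NeZero.pos L
  have hB0 : 0 ≤ B₁ := (abs_nonneg _).trans (hB 0)
  have hfd : 0 ≤ frameDist K K' := frameDist_nonneg K K'
  set C : ℝ := (2 * B₁ + 1) * (β * (L : ℝ) ^ 2) * frameDist K K' with hC
  have hC0 : 0 ≤ C := by positivity
  -- termwise bound by a function of the frequency index only
  have hterm : ∀ ks : FreqMomentum L M × Fin 2,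
      ‖uvSymbolCT L M β μ K Λ ks - uvSymbolCT L M β μ K' Λ ks‖ ≤ C * (1 / max |matsubaraFreq β M ks.1.1| (Λ / 2) ^ 2) := by
    rintro ⟨⟨i, kv⟩, σ⟩
    refine (norm_uvSymbolCT_sub_le hB hβ hΛ μ K K' i kv σ).trans (le_of_eq ?_)
    rw [hC]
    field_simp
  have henv : ∑ i : MatsubaraIdx M, 1 / max |matsubaraFreq β M i| (Λ / 2) ^ 2 ≤ 2 * β / Λ := by
    have h0 := sum_inv_uvEnv_pow_le hβ hΛ M 0
    simpa using h0
  have hcardT : (Fintype.card (TorusSite 2 L) : ℝ) = (L : ℝ) ^ 2 := by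
    rw [show Fintype.card (TorusSite 2 L) = L ^ 2 by simp [TorusSite, ZMod.card]]
    push_cast
    rfl
  calc ∑ ks : FreqMomentum L M × Fin 2, ‖uvSymbolCT L M β μ K Λ ks - uvSymbolCT L M β μ K' Λ ks‖
      ≤ ∑ ks : FreqMomentum L M × Fin 2, C * (1 / max |matsubaraFreq β M ks.1.1| (Λ / 2) ^ 2) := Finset.sum_le_sum fun ks _ => hterm ks
    _ = 2 * (Fintype.card (TorusSite 2 L) : ℝ) * (C * ∑ i : MatsubaraIdx M, 1 / max |matsubaraFreq β M i| (Λ / 2) ^ 2) := by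
        rw [Fintype.sum_prod_type, Fintype.sum_prod_type]
        simp only [Finset.sum_const, Finset.card_univ, Fintype.card_fin, nsmul_eq_mul, Finset.mul_sum]
        refine Finset.sum_congr rfl fun i _ => ?_
        push_cast
        ring
    _ ≤ 2 * (Fintype.card (TorusSite 2 L) : ℝ) * (C * (2 * β / Λ)) := by gcongr
    _ = 2 * (L : ℝ) ^ 2 * ((2 * B₁ + 1) * (β * (L : ℝ) ^ 2)) * (2 * β / Λ) * frameDist K K' := by rw [hcardT, hC]; ring

/-- **The composed scale-`Λ` frame-shift VALUE door for the two-leg kernel** (S6 door (1)): with `s_i = uvSymbolCT … K_i Λ` the one-shot UV symbols of two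
frames and the hypotheses of `covResp_norm_selfEnergy_sub_le` along the interpolation (`Z_t ≠ 0`, four-leg kernels at the reading point `≤ N`, two-leg kernel
`≤ S`): `‖Σ[𝒢(C^{K₁}_{>Λ},V_U)] − Σ[𝒢(C^{K₀}_{>Λ},V_U)]‖(k,σ) ≤ 2|β|L²·(12·(2L²(2B₁+1)βL²(2β/Λ)·frameDist K₁ K₀)·N + 2·(4(2B₁+1)βL²/Λ²·frameDist K₁ K₀)·S²)`
— linear in `frameDist K₁ K₀`, NO hypothesis on the size of the frames (every scale). -/
theorem covResp_norm_selfEnergy_frameShift_sub_le {B₁ : ℝ} (hB : ∀ y, |deriv salmhoferCutoff y| ≤ B₁) {β : ℝ} (hβ : 0 < β) {Λ : ℝ}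
    (hΛ : 0 < Λ) (μ U : ℝ) (K₀ K₁ : TrigPolyC4v) {s₀ s₁ : FreqMomentum L M × Fin 2 → ℂ} (hs₀ : s₀ = uvSymbolCT L M β μ K₀ Λ)
    (hs₁ : s₁ = uvSymbolCT L M β μ K₁ Λ) (k : FreqMomentum L M) (σ : Fin 2)
    (hZ : ∀ t ∈ Set.Icc (0 : ℝ) 1, effPartitionFn ℂ (normalCovariance L M s₀ + ((t : ℂ)) • (normalCovariance L M s₁ - normalCovariance L M s₀))
      (hubbardInteraction L M β U) ≠ 0)
    {N S : ℝ}
    (hN : ∀ t ∈ Set.Icc (0 : ℝ) 1, ∀ A : HubbardFieldIdx L M,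
      ‖kernel ℂ (effAction ℂ (normalCovariance L M s₀ + ((t : ℂ)) • (normalCovariance L M s₁ - normalCovariance L M s₀))
        (hubbardInteraction L M β U)) 4
        (Fin.snoc (Fin.snoc ![(((k, σ), 0) : HubbardFieldIdx L M), ((k, σ), 1)] ((A.1, 1 - A.2)) : Fin 3 → HubbardFieldIdx L M) A)‖ ≤ N)
    (hS : ∀ t ∈ Set.Icc (0 : ℝ) 1,
      ‖kernel ℂ (effAction ℂ (normalCovariance L M s₀ + ((t : ℂ)) • (normalCovariance L M s₁ - normalCovariance L M s₀))
        (hubbardInteraction L M β U)) 2 ![(((k, σ), 0) : HubbardFieldIdx L M), ((k, σ), 1)]‖ ≤ S) :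
    ‖selfEnergy L M β (effAction ℂ (normalCovariance L M s₁) (hubbardInteraction L M β U)) k σ -
        selfEnergy L M β (effAction ℂ (normalCovariance L M s₀) (hubbardInteraction L M β U)) k σ‖ ≤
      2 * (|β| * (L : ℝ) ^ 2) *
        (12 * (2 * (L : ℝ) ^ 2 * ((2 * B₁ + 1) * (β * (L : ℝ) ^ 2)) * (2 * β / Λ) * frameDist K₁ K₀) * N +
          2 * (4 * ((2 * B₁ + 1) * (β * (L : ℝ) ^ 2)) / Λ ^ 2 * frameDist K₁ K₀) * S ^ 2) := by
  have h := covResp_norm_selfEnergy_sub_le s₀ s₁ β U k σ hZ hN hS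
  refine h.trans ?_
  have hN0 : 0 ≤ N := (norm_nonneg _).trans (hN 0 ⟨le_rfl, zero_le_one⟩ ((k, σ), 0))
  have h1 : ∑ p, ‖s₁ p - s₀ p‖ ≤ 2 * (L : ℝ) ^ 2 * ((2 * B₁ + 1) * (β * (L : ℝ) ^ 2)) * (2 * β / Λ) * frameDist K₁ K₀ := by
    subst hs₀ hs₁
    exact sum_norm_uvSymbolCT_sub_le hB hβ hΛ μ K₁ K₀
  have h2 : ‖s₁ (k, σ) - s₀ (k, σ)‖ ≤ 4 * ((2 * B₁ + 1) * (β * (L : ℝ) ^ 2)) / Λ ^ 2 * frameDist K₁ K₀ := by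
    subst hs₀ hs₁
    obtain ⟨i, kv⟩ := k
    exact norm_uvSymbolCT_sub_le_unif hB hβ hΛ μ K₁ K₀ i kv σ
  have hβ' : 0 ≤ 2 * (|β| * (L : ℝ) ^ 2) := by positivity
  refine mul_le_mul_of_nonneg_left (add_le_add ?_ ?_) hβ'
  · exact mul_le_mul_of_nonneg_right (mul_le_mul_of_nonneg_left h1 (by norm_num)) hN0
  · exact mul_le_mul_of_nonneg_right (mul_le_mul_of_nonneg_left h2 (by norm_num)) (sq_nonneg S)

end Summit.HubbardSuperconductivity.HubbardSuperconductivity.Theorems.EngineV8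

end
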